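import Mathlib

/-!
# ChernHallPanov — the positive-product (Panov–Hall) criterion behind the U2 COVER LAW, typed
# (hsemireg-semihom-2 g16; companion of memo `COVER-LAWS-U2-semihom2-g16.md`)

line stmt-HodgeConjecture-18881 Cruxes/BlochSeedDiscOne/Lines/birth.lean 814a6a70c14e831a stub_rung_pad4_seedAt

HONEST FRAMING. Statement-level typed file. `PanovHall n r` is a PUBLISHED theorem of linear algebra (r = n:
Bapat–Raghavan, *Nonnegative matrices and applications*, Thm 5.2.2 — mixed discriminant of PSD matrices is positive iff
no sub-family `T` has `rank (Σ_{i∈T} Aᵢ) < |T|`; Panov 1985; the memo §1.3 reduces `r < n` to `r = n`), stated here as a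
`Prop` and NOT proved in Lean. `CoverCore n` is the matrix-level core of the memo's THEOREM 3.1 (FIVE-COVER ∕ MASS-COVER)
— also only stated. Nothing in this file is a statement about sheaves, designs, the crux `BlochSeedDiscOne`,
`stub_rung_pad4_seedAt`, HC, HC_CM, HC_AV, №4, 26512, 18881 or H2. Mathlib only · no `sorry` · no axioms · no `instance` ·
no `notation` · no unsafe options.

DICTIONARY (memo §1). For a Hermitian `n × n` matrix `A`, `ω(A) = Σ_{jk} A_{jk} dz_j ∧ dz̄_k` is a real (1,1)-form on `ℂⁿ`;
for an `r`-tuple `A₁ … A_r` the coefficient of `dz_I ∧ dz̄_J` (`I, J` injective `r`-tuples of indices) in `ω(A₁) ∧ … ∧ ω(A_r)`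
is `± mixedMinor A I J` (one global sign depending on `r`), so `WedgeVanishes A` says exactly that the wedge product is zero.
In the U2 tower model the Chern–Hall condition for one P letter `ℓ` with hit cover `apex^{m} ⊕ N₁ ⊕ … ⊕ N_k` is
`WedgeVanishes (φ, …, φ, d₁, …, d_k)` in the relevant degree, with `φ = c₁(apex) − c₁(ℓ) ⪰ 0`, `dᵢ = c₁(Nᵢ) − c₁(ℓ) ⪰ 0`.
-/

namespace HsemiregSemihom2.ChernHallPanov

open Matrix

/-- The «mixed minor» of an `r`-tuple of `n × n` complex matrices at row positions `I` and column positions `J`: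
`Σ_{π σ ∈ S_r} sgn σ · Π_k A_{π k} (I k) (J (σ k))` — up to a global sign the coefficient of `dz_I ∧ dz̄_J` in
`ω(A 0) ∧ … ∧ ω(A (r-1))` (memo §1.3; for `r = n`, `I = J = id` it is `(n!)·D(A)` with `D` the mixed discriminant). -/
def mixedMinor {n r : ℕ} (A : Fin r → Matrix (Fin n) (Fin n) ℂ) (I J : Fin r ↪ Fin n) : ℂ :=
  ∑ π : Equiv.Perm (Fin r), ∑ σ : Equiv.Perm (Fin r),
    ((Equiv.Perm.sign σ : ℤ) : ℂ) * ∏ k : Fin r, A (π k) (I k) (J (σ k))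

/-- `ω(A 0) ∧ … ∧ ω(A (r-1)) = 0`: every mixed minor vanishes. -/
def WedgeVanishes {n r : ℕ} (A : Fin r → Matrix (Fin n) (Fin n) ℂ) : Prop :=
  ∀ I J : Fin r ↪ Fin n, mixedMinor A I J = 0

/-- A rank-deficient sub-family: `T ⊆ Fin r` with `rank (Σ_{i∈T} A i) < |T|` (for PSD matrices equivalently
`dim ⋂_{i∈T} ker (A i) > n − |T|`). -/
def Deficient {n r : ℕ} (A : Fin r → Matrix (Fin n) (Fin n) ℂ) : Prop :=
  ∃ T : Finset (Fin r), (∑ i ∈ T, A i).rank < T.card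

section
open scoped ComplexOrder

/-- PANOV–HALL criterion (Bapat–Raghavan Thm 5.2.2 for `r = n`; memo §1.3 LEMMA 2 for `r ≤ n`): for positive semidefinite
Hermitian `A i`, the wedge product of the forms `ω(A i)` vanishes iff some sub-family is rank-deficient.
PUBLISHED RESULT, stated as a `Prop`; not proved here. -/
def PanovHall (n r : ℕ) : Prop :=
  ∀ A : Fin r → Matrix (Fin n) (Fin n) ℂ, (∀ i, (A i).PosSemidef) → (WedgeVanishes A ↔ Deficient A)

/-- Matrix-level core of the memo's THEOREM 3.1 (COVER LAW ⇒ FIVE-COVER), dimension `n = 8`, apex multiplicity `4`: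
if `φ ⪰ 0`, the `k ≤ 4` cover classes `d i ⪰ 0` have NO rank-deficient sub-family, and adding `φ` to any non-empty
sub-sum gives full rank while `rank φ ≥ 4` (memo §2: deficiency floor 7 and apex alignment on the x₀ tower), then the
degree-`(4+k)` Chern–Hall identity `φ⁴ · d₁ ⋯ d_k = 0` is IMPOSSIBLE, i.e. the wedge does not vanish.  Stated only; it is the
instance of `PanovHall 8 (4 + k)` spelled out in the memo. -/
def CoverCore : Prop :=
  ∀ (k : ℕ) (φ : Matrix (Fin 8) (Fin 8) ℂ) (d : Fin k → Matrix (Fin 8) (Fin 8) ℂ),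
    k ≤ 4 → φ.PosSemidef → (∀ i, (d i).PosSemidef) →
    (∀ T : Finset (Fin k), T.card ≤ (∑ i ∈ T, d i).rank) →
    (∀ T : Finset (Fin k), T.Nonempty → (φ + ∑ i ∈ T, d i).rank = 8) →
    4 ≤ φ.rank →
      ¬ WedgeVanishes (Fin.append (fun _ : Fin 4 => φ) d)

end

/-- Sanity (kernel-checked): with no factors (`r = 0`) the only mixed minor is the empty product `1`, so the empty wedge
(the constant form `1`) does not vanish. -/
theorem mixedMinor_zero {n : ℕ} (A : Fin 0 → Matrix (Fin n) (Fin n) ℂ) (I J : Fin 0 ↪ Fin n) :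
    mixedMinor A I J = 1 := by
  simp [mixedMinor]

theorem not_wedgeVanishes_zero {n : ℕ} (A : Fin 0 → Matrix (Fin n) (Fin n) ℂ) : ¬ WedgeVanishes A := by
  intro h
  have h1 := h ⟨Fin.elim0, fun i => Fin.elim0 i⟩ ⟨Fin.elim0, fun i => Fin.elim0 i⟩
  rw [mixedMinor_zero] at h1
  exact one_ne_zero h1

/-- … and no sub-family of an empty family is deficient, consistent with `PanovHall n 0`. -/
theorem not_deficient_zero {n : ℕ} (A : Fin 0 → Matrix (Fin n) (Fin n) ℂ) : ¬ Deficient A := by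
  rintro ⟨T, hT⟩
  have : T = ∅ := Finset.eq_empty_of_isEmpty T
  subst this
  simp at hT

/-- Hence the `r = 0` instance of the criterion holds outright. -/
theorem panovHall_zero (n : ℕ) : PanovHall n 0 := by
  intro A _
  exact ⟨fun h => (not_wedgeVanishes_zero A h).elim, fun h => (not_deficient_zero A h).elim⟩

end HsemiregSemihom2.ChernHallPanov
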